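import Summits.QuantumFields.GaugeBoot.StrongCouplingRectangleLinks
import HarnessLib

/-!
# Strong coupling from the loop equation: ALL-ORDER decay of rectangular Wilson loops, `|⟨W̄(R×T)⟩| ≤ a^{2(R+T)−4}` (gauge-boot, ADDENDUM 26 part C)

HONEST FRAMING (cell `pub-gaugeboot`, page 1 of every file): the venture produces certified bounds
on lattice expectations at stated coupling, gauge group, dimension and torus size; NOT a mass gap,
NOT a continuum limit, NOT a string tension; NOT Yang–Mills-summit-bearing (barriers
`FixedCouplingUltralocality`, `PerturbativeInvisibility`).  A crude explicit strong-coupling bound, valid on every torus and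
at every real coupling; NOT an area law (the exponent is the perimeter less four, which is the area only for loops of
width `≤ 2`); it certifies no number of the cell's tables.

## Content (`SU(N)`, `N ≥ 2`, fundamental representation, torus `(ℤ/L)^D`)

The read-many bound (`StrongCouplingReadMany`) applied to the rectangle word, with the links of
`StrongCouplingRectangleLinks`:

* the separated families: `pairwise_separated_side` (the links of one side, e.g. the `R` bottom or the `T` right
  links); ★ `pairwise_separated_perimeterFamily` — for `2 ≤ R ≤ L − 2`, `2 ≤ T ≤ L − 2` the `2(R+T) − 4` links =
  bottom + top + the inner links of both sides (a corner link and its neighbour round the corner lie on a common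
  plaquette; nothing else does);
* ★★ `abs_wilsonLoopExpectation_le_pow_of_family` — the transfer: a separated once-read family of `k` links gives
  `|wilsonLoopExpectation N D L β R T| ≤ (4(D−1)|β|/(N²−1))^k`;
* ★★★ `abs_wilsonLoopExpectation_le_pow`: **`|wilsonLoopExpectation N D L β R T| ≤ (4(D−1)|β|/(N²−1))^{2(R+T)−4}`**
  for `2 ≤ R ≤ L − 2`, `2 ≤ T ≤ L − 2`, every real `β`; ★★ `abs_wilsonLoopExpectation_le_pow_snd / _fst`:
  **`≤ (4(D−1)|β|/(N²−1))^T`** and **`≤ (…)^R`** for `1 ≤ R, T < L` (for the `1 × T` and `2 × T` loops the exponent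
  `T` resp. `2T` is the AREA, the order of the strong-coupling series); `SU(3)`, `D = 4`: `(3|β|/2)^{2(R+T)−4}`;
  `SU(2)`, `D = 4`: `(4|β|)^{2(R+T)−4}`.

References: I. Montvay, G. Münster, *Quantum fields on a lattice* (1994) §3.4.5, eqs (3.397)–(3.400) (strong-coupling
area law `W ≈ 2u^{RT}` by the character expansion); K. Osterwalder, E. Seiler, Ann. Phys. 110 (1978) 440 (its
convergence).  Everything is `[folklore]`.
-/

noncomputable section

open MeasureTheory Filter Topology NormedSpace
open scoped Matrix.Norms.Frobenius Matrix
open Literature.MathematicalPhysics.QuantumFieldTheory Literature.MathematicalPhysics.QuantumLattice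
open Summit.QuantumFields.YangMills.Cruxes.CurvatureAmnesia.WardDefect.SchwingerDyson

namespace Summit.QuantumFields.GaugeBoot

namespace StrongCoupling

variable {d L N : ℕ}

/-! ## The separated families of a rectangle -/

section Families

/-- **Pairwise separation along one side**: the links `(y + m e_k, k)`, `m < n ≤ L`, listed by `m`, are pairwise separated.
[folklore] -/
theorem pairwise_separated_side (hL : (1 : ZMod L) ≠ 0) (y : Site d L) (k : Fin d) {n : ℕ} (hn : n ≤ L) :
    ((List.range n).map fun m => ((y + Pi.single k ((m : ℕ) : ZMod L), k) : Edge d L)).Pairwise Separated := by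
  rw [List.pairwise_map]
  refine (List.pairwise_lt_range : (List.range n).Pairwise (· < ·)).imp_of_mem fun {a b} ha hb hab => ?_
  rw [List.mem_range] at ha hb
  refine separated_of_apply_eq hL (fun e => ?_) fun c hc => by simp [Pi.single_eq_of_ne hc]
  have h1 := congrArg (fun z : Site d L => z k) e
  simp only [Pi.add_apply, Pi.single_eq_same, add_right_inj] at h1
  exact (natCast_zmod_ne (by omega) (by omega) hab.ne) h1.symm

variable (x : Site d L) {i j : Fin d} (hij : i ≠ j)
include hij

/-- ★ **The family of all four sides less the corner neighbours** (`2 ≤ R ≤ L − 2`, `2 ≤ T ≤ L − 2`): bottom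
`(x + k e_i, i)`, top `(x + k e_i + T e_j, i)` (`k < R`), inner left `(x + m e_j, j)`, inner right `(x + R e_i + m e_j, j)`
(`1 ≤ m ≤ T − 2`), in this order, is pairwise separated. [folklore] -/
theorem pairwise_separated_perimeterFamily {R T : ℕ} (hR : 2 ≤ R) (hRL : R + 2 ≤ L) (hT : 2 ≤ T) (hTL : T + 2 ≤ L) :
    (((List.range R).map fun k => ((x + Pi.single i ((k : ℕ) : ZMod L), i) : Edge d L)) ++
      ((List.range R).map fun k => ((x + Pi.single i ((k : ℕ) : ZMod L) + Pi.single j ((T : ℕ) : ZMod L), i) : Edge d L)) ++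
      ((List.range (T - 2)).map fun m => ((x + Pi.single j (((m + 1 : ℕ) : ℕ) : ZMod L), j) : Edge d L)) ++
      ((List.range (T - 2)).map fun m =>
        ((x + Pi.single i ((R : ℕ) : ZMod L) + Pi.single j (((m + 1 : ℕ) : ℕ) : ZMod L), j) : Edge d L))).Pairwise Separated := by
  have hji : j ≠ i := fun h => hij h.symm
  have hL : (1 : ZMod L) ≠ 0 := zmod_one_ne_zero (by omega)
  -- `T, R ∉ {0, 1, −1}` and `m + 1 ∉ {0, −1}`, `m + 1 − T ∉ {0, −1}` in `ℤ/L`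
  have hT0 : ((T : ℕ) : ZMod L) ≠ 0 := natCast_zmod_ne_zero (by omega) (by omega)
  have hT1 : ((T : ℕ) : ZMod L) ≠ 1 := fun h => natCast_zmod_ne_zero (L := L) (m := T - 1) (by omega) (by omega) (by
    rw [Nat.cast_sub (by omega : 1 ≤ T), h, Nat.cast_one, sub_self])
  have hT2 : ((T : ℕ) : ZMod L) ≠ -1 := fun h => natCast_zmod_ne_zero (L := L) (m := T + 1) (by omega) (by omega) (by
    rw [Nat.cast_succ, h, neg_add_cancel])
  have hR0 : ((R : ℕ) : ZMod L) ≠ 0 := natCast_zmod_ne_zero (by omega) (by omega)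
  have hR1 : ((R : ℕ) : ZMod L) ≠ 1 := fun h => natCast_zmod_ne_zero (L := L) (m := R - 1) (by omega) (by omega) (by
    rw [Nat.cast_sub (by omega : 1 ≤ R), h, Nat.cast_one, sub_self])
  have hR2 : ((R : ℕ) : ZMod L) ≠ -1 := fun h => natCast_zmod_ne_zero (L := L) (m := R + 1) (by omega) (by omega) (by
    rw [Nat.cast_succ, h, neg_add_cancel])
  have hm0 : ∀ m, m < T - 2 → (((m + 1 : ℕ) : ℕ) : ZMod L) ≠ 0 := fun m hm => natCast_zmod_ne_zero (by omega) (by omega)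
  have hm1 : ∀ m, m < T - 2 → (((m + 1 : ℕ) : ℕ) : ZMod L) ≠ -1 := fun m hm h =>
    natCast_zmod_ne_zero (L := L) (m := m + 2) (by omega) (by omega) (by
      rw [show m + 2 = (m + 1) + 1 by omega, Nat.cast_succ, h, neg_add_cancel])
  have hmT0 : ∀ m, m < T - 2 → (((m + 1 : ℕ) : ℕ) : ZMod L) - ((T : ℕ) : ZMod L) ≠ 0 := fun m hm h => by
    rw [sub_eq_zero] at h
    exact absurd (natCast_zmod_inj (by omega) (by omega) h) (by omega)
  have hmT1 : ∀ m, m < T - 2 → (((m + 1 : ℕ) : ℕ) : ZMod L) - ((T : ℕ) : ZMod L) ≠ -1 := fun m hm h => by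
    have h' : ((T : ℕ) : ZMod L) = (((m + 2 : ℕ) : ℕ) : ZMod L) := by
      rw [show m + 2 = (m + 1) + 1 by omega, Nat.cast_succ (m + 1)]; linear_combination -h
    exact absurd (natCast_zmod_inj (by omega) (by omega) h') (by omega)
  -- the six kinds of cross pairs and the four sides
  simp only [List.pairwise_append, List.mem_map, List.mem_range, List.mem_append]
  refine ⟨⟨⟨pairwise_separated_side hL x i (by omega), ?_, ?_⟩, ?_, ?_⟩, ?_, ?_⟩
  · -- top
    have h := pairwise_separated_side hL (x + Pi.single j ((T : ℕ) : ZMod L)) i (n := R) (by omega)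
    convert h using 2
    funext k
    rw [add_right_comm]
  · -- bottom → top
    rintro a ⟨k, _, rfl⟩ b ⟨k', _, rfl⟩
    refine separated_of_apply_sub hji ?_ ?_ ?_ <;>
      simp [Pi.single_eq_of_ne hji, hT0, hT1, hT2]
  · -- inner left
    have h := pairwise_separated_side hL (x + Pi.single j (1 : ZMod L)) j (n := T - 2) (by omega)
    convert h using 2
    funext m
    rw [Nat.cast_succ, Pi.single_add, Prod.mk.injEq]
    exact ⟨by abel, rfl⟩
  · -- bottom, top → inner left
    rintro a (⟨k, _, rfl⟩ | ⟨k, _, rfl⟩) b ⟨m, hm, rfl⟩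
    · exact separated_of_ne_of_apply_sub hji (by simpa [Pi.single_eq_of_ne hji] using hm0 m hm)
        (by simpa [Pi.single_eq_of_ne hji] using hm1 m hm)
    · exact separated_of_ne_of_apply_sub hji (by simpa [Pi.single_eq_of_ne hji] using hmT0 m hm)
        (by simpa [Pi.single_eq_of_ne hji] using hmT1 m hm)
  · -- inner right
    have h := pairwise_separated_side hL (x + Pi.single i ((R : ℕ) : ZMod L) + Pi.single j (1 : ZMod L)) j
      (n := T - 2) (by omega)
    convert h using 2
    funext m
    rw [Nat.cast_succ, Pi.single_add, Prod.mk.injEq]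
    exact ⟨by abel, rfl⟩
  · -- bottom, top, inner left → inner right
    rintro a ((⟨k, _, rfl⟩ | ⟨k, _, rfl⟩) | ⟨m', _, rfl⟩) b ⟨m, hm, rfl⟩
    · exact separated_of_ne_of_apply_sub hji (by simpa [Pi.single_eq_of_ne hji] using hm0 m hm)
        (by simpa [Pi.single_eq_of_ne hji] using hm1 m hm)
    · exact separated_of_ne_of_apply_sub hji (by simpa [Pi.single_eq_of_ne hji] using hmT0 m hm)
        (by simpa [Pi.single_eq_of_ne hji] using hmT1 m hm)
    · refine separated_of_apply_sub hij ?_ ?_ ?_ <;>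
        simp [Pi.single_eq_of_ne hij, hR0, hR1, hR2]

end Families

/-! ## The bounds -/

section Bounds

variable {N D L : ℕ} [NeZero L]

/-- ★★ **Every Wilson loop, standard coupling**: if the closed word `W` reads each link of the list `F` exactly once and the
links of `F` are pairwise separated, then `|⟨(1/N) Re tr hol_x W⟩_{β_std}| ≤ (4(D−1)|β_std|/(N²−1))^{|F|}` on every torus, at
every real `β_std` (tree coupling `β_std/N`). [folklore] -/
theorem abs_wilsonExpectation_wordLoop_le_pow_of_family (hN : 2 ≤ N) (β : ℝ) (x : Site D L) (W : Word D)
    (hW : Word.endpoint x W = x) (F : List (Edge D L)) (hcount : ∀ e ∈ F, (Word.edgesRead x W).count e = 1)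
    (hsep : F.Pairwise Separated) :
    |wilsonExpectation (suRep N) (β / N) (wordLoop (suRep N) x W)| ≤ (4 * ((D : ℝ) - 1) * |β| / ((N : ℝ) ^ 2 - 1)) ^ F.length := by
  have hN2 : (2 : ℝ) ≤ N := by exact_mod_cast hN
  have hNpos : (0 : ℝ) < N := by linarith
  have hmain := norm_integral_trace_suN_le_of_separated (d := D) (L := L) hN (β / N) F x W hW hcount hsep
  have hW := wilsonExpectation_wordLoop_eq_re_integral_latticeRep (d := D) (L := L) (fundamentalLatticeRep N) (β / N) x W
  simp only [fundamentalLatticeRep_N, fundamentalLatticeRep_ρ] at hW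
  rw [hW, abs_mul, abs_inv, Nat.abs_cast]
  have hre := Complex.abs_re_le_norm (∫ U, (fundamentalRep (Fin N) (wordHolonomy U x W)).trace
    ∂(wilsonMeasure (d := D) (L := L) (fundamentalRep (Fin N)) (β / N)))
  refine (mul_le_mul_of_nonneg_left (hre.trans hmain) (inv_nonneg.2 hNpos.le)).trans (le_of_eq ?_)
  rw [abs_div, Nat.abs_cast, inv_mul_cancel_left₀ hNpos.ne']
  congr 1
  field_simp

/-- ★★ **Transfer to rectangles**: if the links of the list `F` are each read exactly once by the rectangle word and are pairwise
separated, then `|wilsonLoopExpectation N D L β R T| ≤ (4(D−1)|β|/(N²−1))^{|F|}`. [folklore] -/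
theorem abs_wilsonLoopExpectation_le_pow_of_family (hN : 2 ≤ N) (β : ℝ) (R T : ℕ) (x : Site D L) {i j : Fin D} (hij : i ≠ j)
    (F : List (Edge D L)) (hcount : ∀ e ∈ F, (Word.edgesRead x (Word.rectangle i j R T)).count e = 1)
    (hsep : F.Pairwise Separated) :
    |wilsonLoopExpectation N D L β R T| ≤ (4 * ((D : ℝ) - 1) * |β| / ((N : ℝ) ^ 2 - 1)) ^ F.length := by
  rw [wilsonLoopExpectation_eq_wordLoop N D L β R T x hij]
  exact abs_wilsonExpectation_wordLoop_le_pow_of_family hN β x _ (Word.endpoint_rectangle x i j R T) F hcount hsep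

/-- ★★ **`|⟨W̄(R×T)⟩| ≤ (4(D−1)|β|/(N²−1))^R`** for `SU(N)`, `N ≥ 2`, `D ≥ 2`, `1 ≤ R ≤ L − 1`, `1 ≤ T ≤ L − 1`, every real
`β` (the `R` bottom links). [folklore] -/
theorem abs_wilsonLoopExpectation_le_pow_fst (hN : 2 ≤ N) (hD : 2 ≤ D) {R T : ℕ} (hR1 : 1 ≤ R) (hR : R < L) (hT1 : 1 ≤ T)
    (hT : T < L) (β : ℝ) : |wilsonLoopExpectation N D L β R T| ≤ (4 * ((D : ℝ) - 1) * |β| / ((N : ℝ) ^ 2 - 1)) ^ R := by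
  obtain ⟨i, j, hij⟩ : ∃ i j : Fin D, i ≠ j := ⟨⟨0, by omega⟩, ⟨1, by omega⟩, by simp [Fin.ext_iff]⟩
  have hL : (1 : ZMod L) ≠ 0 := zmod_one_ne_zero (by omega)
  set x : Site D L := fun _ => 0
  have h := abs_wilsonLoopExpectation_le_pow_of_family hN β R T x hij
    ((List.range R).map fun k => ((x + Pi.single i ((k : ℕ) : ZMod L), i) : Edge D L)) (fun e he => by
      obtain ⟨k, hk, rfl⟩ := List.mem_map.1 he
      exact List.count_eq_one_of_mem (nodup_edgesRead_rectangle x hij hR1 hR hT1 hT)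
        (bottom_mem_edgesRead_rectangle x i j (List.mem_range.1 hk) T))
    (pairwise_separated_side hL x i hR.le)
  rwa [List.length_map, List.length_range] at h

/-- ★★ **`|⟨W̄(R×T)⟩| ≤ (4(D−1)|β|/(N²−1))^T`** (the `T` right links) — for `R ≤ 2` the exponent `T` resp. (with `_le_pow`)
`2T` is the AREA of the loop, the order of its strong-coupling series. [folklore] -/
theorem abs_wilsonLoopExpectation_le_pow_snd (hN : 2 ≤ N) (hD : 2 ≤ D) {R T : ℕ} (hR1 : 1 ≤ R) (hR : R < L) (hT1 : 1 ≤ T)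
    (hT : T < L) (β : ℝ) : |wilsonLoopExpectation N D L β R T| ≤ (4 * ((D : ℝ) - 1) * |β| / ((N : ℝ) ^ 2 - 1)) ^ T := by
  obtain ⟨i, j, hij⟩ : ∃ i j : Fin D, i ≠ j := ⟨⟨0, by omega⟩, ⟨1, by omega⟩, by simp [Fin.ext_iff]⟩
  have hL : (1 : ZMod L) ≠ 0 := zmod_one_ne_zero (by omega)
  set x : Site D L := fun _ => 0
  have h := abs_wilsonLoopExpectation_le_pow_of_family hN β R T x hij
    ((List.range T).map fun m => ((x + Pi.single i ((R : ℕ) : ZMod L) + Pi.single j ((m : ℕ) : ZMod L), j) : Edge D L))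
    (fun e he => by
      obtain ⟨m, hm, rfl⟩ := List.mem_map.1 he
      exact List.count_eq_one_of_mem (nodup_edgesRead_rectangle x hij hR1 hR hT1 hT)
        (right_mem_edgesRead_rectangle x i j R (List.mem_range.1 hm)))
    (pairwise_separated_side hL _ j hT.le)
  rwa [List.length_map, List.length_range] at h

/-- ★★★ **ALL-ORDER STRONG-COUPLING DECAY OF WILSON LOOPS, EXPLICIT AND UNIFORM IN THE VOLUME.**  For `SU(N)`, `N ≥ 2`, `D ≥ 2`,
`2 ≤ R ≤ L − 2`, `2 ≤ T ≤ L − 2` and EVERY real standard coupling `β`: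
`|wilsonLoopExpectation N D L β R T| ≤ (4(D−1)|β|/(N²−1))^{2(R+T)−4}` — the perimeter less four: the `2(R+T) − 4` boundary
links other than one neighbour of each corner are pairwise separated and each is read once. [folklore] -/
theorem abs_wilsonLoopExpectation_le_pow (hN : 2 ≤ N) (hD : 2 ≤ D) {R T : ℕ} (hR : 2 ≤ R) (hRL : R + 2 ≤ L) (hT : 2 ≤ T)
    (hTL : T + 2 ≤ L) (β : ℝ) :
    |wilsonLoopExpectation N D L β R T| ≤ (4 * ((D : ℝ) - 1) * |β| / ((N : ℝ) ^ 2 - 1)) ^ (2 * (R + T) - 4) := by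
  obtain ⟨i, j, hij⟩ : ∃ i j : Fin D, i ≠ j := ⟨⟨0, by omega⟩, ⟨1, by omega⟩, by simp [Fin.ext_iff]⟩
  set x : Site D L := fun _ => 0
  have hnd := nodup_edgesRead_rectangle x hij (R := R) (T := T) (by omega) (by omega) (by omega) (by omega)
  have h := abs_wilsonLoopExpectation_le_pow_of_family hN β R T x hij _ (fun e he => ?_)
    (pairwise_separated_perimeterFamily x hij hR hRL hT hTL)
  · simp only [List.length_append, List.length_map, List.length_range] at h
    rwa [show R + R + (T - 2) + (T - 2) = 2 * (R + T) - 4 by omega] at h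
  · simp only [List.mem_append, List.mem_map, List.mem_range] at he
    rcases he with ((⟨k, hk, rfl⟩ | ⟨k, hk, rfl⟩) | ⟨m, hm, rfl⟩) | ⟨m, hm, rfl⟩
    · exact List.count_eq_one_of_mem hnd (bottom_mem_edgesRead_rectangle x i j hk T)
    · exact List.count_eq_one_of_mem hnd (top_mem_edgesRead_rectangle x i j hk T)
    · exact List.count_eq_one_of_mem hnd (left_mem_edgesRead_rectangle x i j R (by omega))
    · exact List.count_eq_one_of_mem hnd (right_mem_edgesRead_rectangle x i j R (by omega))

/-- `SU(3)`, `D = 4`: `|wilsonLoopExpectation 3 4 L β R T| ≤ (3|β|/2)^{2(R+T)−4}` for `2 ≤ R, T ≤ L − 2`, every real `β`.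
[folklore] -/
theorem abs_wilsonLoopExpectation_three_four_le_pow {R T : ℕ} (hR : 2 ≤ R) (hRL : R + 2 ≤ L) (hT : 2 ≤ T) (hTL : T + 2 ≤ L)
    (β : ℝ) : |wilsonLoopExpectation 3 4 L β R T| ≤ (3 * |β| / 2) ^ (2 * (R + T) - 4) := by
  have h := abs_wilsonLoopExpectation_le_pow (N := 3) (D := 4) (L := L) (by norm_num) (by norm_num) hR hRL hT hTL β
  norm_num at h
  convert h using 2
  ring

/-- `SU(2)`, `D = 4`: `|wilsonLoopExpectation 2 4 L β R T| ≤ (4|β|)^{2(R+T)−4}` for `2 ≤ R, T ≤ L − 2`, every real `β`.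
[folklore] -/
theorem abs_wilsonLoopExpectation_two_four_le_pow {R T : ℕ} (hR : 2 ≤ R) (hRL : R + 2 ≤ L) (hT : 2 ≤ T) (hTL : T + 2 ≤ L)
    (β : ℝ) : |wilsonLoopExpectation 2 4 L β R T| ≤ (4 * |β|) ^ (2 * (R + T) - 4) := by
  have h := abs_wilsonLoopExpectation_le_pow (N := 2) (D := 4) (L := L) (by norm_num) (by norm_num) hR hRL hT hTL β
  norm_num at h
  convert h using 2
  ring

end Bounds

end StrongCoupling

end Summit.QuantumFields.GaugeBoot

end
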